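import Summits.BirchSwinnertonDyer.BirchSwinnertonDyer.Theorems.Rank1ResidualX9Defs
import Literature.NumberTheory.EllipticCurves.NonvanishingTwistsAdmissibleFieldOfFriedbergHoffsteinProofs
import Literature.NumberTheory.EllipticCurves.Rank1Residual.ClassX1KellerYin
import Literature.NumberTheory.EllipticCurves.RootNumberEvenAnalyticRankProofs
import HarnessLib

/-!
# The LIGHT frame supply on class X9 in analytic rank one (`d_K` odd, `d_K < −4`, Heegner for `N_E`,
# `p` split, `L(E^{(d_K)}, 1) ≠ 0`; NO class-number conjunct) — item `LightFrameSupplyOdd`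
# (stmt-BirchSwinnertonDyer-23163, support r9 of `route-BirchSwinnertonDyer-TorsionLayerDescent`) —
# REDUCED IN THE KERNEL to published named facts: Friedberg–Hoffstein 1995 Thm. B (1) (finite-set form,
# as applied by Jetchev–Skinner–Wan 2017 §7.4.1–7.4.2) + modularity (for the sign `w(E) = (−1)^{r_an}`),
# resp. Hoffstein–Luo 1997 + modularity

HONEST FRAMING (cell `run/shared/lean/pub/bsd-print-x9/`, D-0131 print tier; typer seat ty3 = frame
supply / certificate records, serving the TorsionLayerDescent pen's open hand «the 10-line closing file
[for F] to whoever sits first», `pub/bsd-print-x9/INBOX.md` 2026-08-27T23:10:36Z (P1) — hence the file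
lives in the cell's typer tree `Rank1Residual/X9/`, not under `BirchSwinnertonDyer/Theorems/`
(prover-only, D-0016); the proof is attached as evidence on item 23163). THEOREMS ONLY: no definition,
no named fact, no `sorry`; nothing booked, nothing closed. ROUTE-FREE: no `Theses.*` import — the
conclusions below are the item's definiens VERBATIM (`Theses/TorsionLayerDescent.lean` rev 0 l.244–245),
so a consumer needing `hF : Theses.TorsionLayerDescent.LightFrameSupplyOdd` is fed
`lightFrameSupplyOdd_of_friedbergHoffstein hnf hFH` by δ-unfolding. The item is NOT closed flag-free:
its inputs after this file are exactly the two cite-only named facts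
`friedbergHoffstein_exists_heegnerField_splitDivisors_twist_ne_zero` (Friedberg–Hoffstein, Ann. of Math.
142 (1995) Thm. B (1), special case: quadratic characters with prescribed SPLIT local components at the
finite set `{∞, 2, p} ∪ {ℓ ∣ N_E}`, sign `+1`; the form printed in Jetchev–Skinner–Wan 2017 §7.4.1 p. 30 /
§7.4.2 p. 31 and Burungale–Skinner–Tian–Wan 2024 Part II proof of Thm. 4.3) and
`ModularForms.exists_isNewformOf` (modularity, BCDT 2001 Thm. A — already conjunct 8 of the route's
`DescentPrintFacts`, item 23165), resp. `HoffsteinLuo1997_exists_twist_L_one_ne_zero` (Math. Res. Lett. 4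
(1997), Theorem pp. 435–436) for the twin. «beyond-print theorem»: NO (the item is PRINT; this is its
kernel transcription). BSD is not proved by any of this.

WHAT.
* `lightFrameSupplyOdd_of_friedbergHoffstein (hnf) (hFH)` — for every globally minimal elliptic `W/ℚ`
  and prime `p` with `ClassX9 W p` (not used) and `ord_{s=1} L(E, s) = 1`: an imaginary quadratic `K`
  with `d_K` odd, `d_K < −4`, every prime of `N_E` split, `p` split, `L(E^{(d_K)}, 1) ≠ 0`. Proof =
  `w(E) = (−1)^{r_an} = −1` (`rootNumber_eq_neg_one_pow_analyticRank_of_exists_isNewformOf`, from `hnf`)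
  then the tree theorem `Rank1Residual.exists_admissibleField_of_rootNumber_eq_neg_one_of_friedbergHoffstein`
  (`M = 8p`, `B = 4`: `2 ∣ M` split ⟹ `d_K ≡ 1 (mod 8)` ⟹ odd; `|d_K| > 4`).
* `lightFrameSupplyOdd_of_hoffsteinLuo (hnf) (hHL)` — the same conclusion from Hoffstein–Luo's theorem
  (tree theorem `Rank1Residual.exists_admissibleField_of_rootNumber_eq_neg_one`, Keller–Yin §0.1 /
  CGLS proof of Thm. 5.3.1 (a)–(d)).
* `exists_lightFrame_of_rootNumber_eq_neg_one_of_friedbergHoffstein (hFH)` — the modularity-free core: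
  the frame from `w(E) = −1` alone (no `ClassX9`, no minimality), for roads that carry the sign.

References: [FriedbergHoffstein1995] Thm. B (1); [JetchevSkinnerWan2017] §7.4.1–7.4.2;
[BurungaleSkinnerTianWan2024] Part II, proof of Thm. 4.3; [HoffsteinLuo1997] Theorem (§1);
[BCDTJAMS2001] Thm. A; [SilvermanAEC2009] C.16 Thm. 16.3; route file `Theses/TorsionLayerDescent.lean`
(rev 0, item 23163) — text only, not imported.
-/

-- the summit namespace `Summit.BirchSwinnertonDyer.BirchSwinnertonDyer.…` repeats the summit name
set_option linter.dupNamespace false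
set_option autoImplicit false

noncomputable section

open WeierstrassCurve Literature.NumberTheory.EllipticCurves
  Literature.NumberTheory.EllipticCurves.ModularForms

namespace Summit.BirchSwinnertonDyer.BirchSwinnertonDyer.Rank1Residual

namespace TorsionLayer

/-- **The light Heegner frame from the sign alone (Friedberg–Hoffstein).** For `W/ℚ` elliptic with
`w(W) = −1` and any prime `p`: an imaginary quadratic `K` with `d_K` odd, `d_K < −4`, the Heegner
hypothesis for `N_W` and for `p`, and `L(W^{(d_K)}, 1) ≠ 0` — the tree theorem
`Rank1Residual.exists_admissibleField_of_rootNumber_eq_neg_one_of_friedbergHoffstein` re-exported in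
the route's binder order. [cite: FriedbergHoffstein1995, Thm. B (1) (as applied in JetchevSkinnerWan2017 §7.4.1–7.4.2)] -/
theorem exists_lightFrame_of_rootNumber_eq_neg_one_of_friedbergHoffstein
    (hFH : friedbergHoffstein_exists_heegnerField_splitDivisors_twist_ne_zero)
    (W : WeierstrassCurve ℚ) [W.IsElliptic] (p : ℕ) [Fact p.Prime] (hw : W.rootNumber = -1) :
    ∃ (K : Type) (_ : Field K) (_ : NumberField K),
      Literature.NumberTheory.EllipticCurves.IsImaginaryQuadratic K ∧ Odd (NumberField.discr K) ∧
        NumberField.discr K < -4 ∧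
        Literature.NumberTheory.EllipticCurves.SatisfiesHeegnerHypothesis (W.conductorNorm ℤ) K ∧
        Literature.NumberTheory.EllipticCurves.SatisfiesHeegnerHypothesis p K ∧
        (W.quadraticTwist (NumberField.discr K : ℚ)).entireLFunction 1 ≠ 0 :=
  Literature.NumberTheory.EllipticCurves.Rank1Residual.exists_admissibleField_of_rootNumber_eq_neg_one_of_friedbergHoffstein
    hFH W hw p

/-- **`LightFrameSupplyOdd` from Friedberg–Hoffstein 1995 Thm. B (1) and modularity** — the definiens
of item stmt-BirchSwinnertonDyer-23163 VERBATIM as conclusion: every X9 pair `(W, p)` of analytic rank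
one has an imaginary quadratic `K` with `d_K` odd `< −4`, Heegner for `N_E`, `p` split, and
`L(E^{(d_K)}, 1) ≠ 0`. The sign `w(E) = (−1)^{r_an(E)} = −1` is
`rootNumber_eq_neg_one_pow_analyticRank_of_exists_isNewformOf hnf` (BCDT modularity + Hecke's
functional equation, a tree theorem modulo `hnf`); the class hypothesis `ClassX9 W p` is not used.
[cite: FriedbergHoffstein1995, Thm. B (1) (as applied in JetchevSkinnerWan2017 §7.4.1 p. 30, §7.4.2 p. 31)]
[cite: BCDTJAMS2001, Thm. A] [cite: SilvermanAEC2009, C.16 Thm. 16.3 and remark, p. 451] -/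
theorem lightFrameSupplyOdd_of_friedbergHoffstein (hnf : exists_isNewformOf)
    (hFH : friedbergHoffstein_exists_heegnerField_splitDivisors_twist_ne_zero) :
    ∀ (W : WeierstrassCurve ℚ) [W.IsElliptic] [W.IsGloballyMinimal] [NeZero (W.conductorNorm ℤ)] (p : ℕ) [Fact p.Prime], Summit.BirchSwinnertonDyer.BirchSwinnertonDyer.Rank1Residual.ClassX9 W p → W.analyticRank = 1 → ∃ (K : Type) (_ : Field K) (_ : NumberField K), Literature.NumberTheory.EllipticCurves.IsImaginaryQuadratic K ∧ Odd (NumberField.discr K) ∧ NumberField.discr K < -4 ∧ Literature.NumberTheory.EllipticCurves.SatisfiesHeegnerHypothesis (W.conductorNorm ℤ) K ∧ Literature.NumberTheory.EllipticCurves.SatisfiesHeegnerHypothesis p K ∧ (W.quadraticTwist (NumberField.discr K : ℚ)).entireLFunction 1 ≠ 0 := by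
  intro W _ _ _ p _ _ hr
  have hw : W.rootNumber = -1 := by
    rw [W.rootNumber_eq_neg_one_pow_analyticRank_of_exists_isNewformOf hnf, hr, pow_one]
  exact exists_lightFrame_of_rootNumber_eq_neg_one_of_friedbergHoffstein hFH W p hw

/-- **`LightFrameSupplyOdd` from Hoffstein–Luo 1997 and modularity** — the same conclusion (item
23163's definiens VERBATIM) from the Hoffstein–Luo-rooted tree theorem
`Rank1Residual.exists_admissibleField_of_rootNumber_eq_neg_one` (the admissible field of the class-X1
assembly: Castella–Grossi–Lee–Skinner, proof of Thm. 5.3.1 (a)–(d); Keller–Yin §0.1), the sign again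
from `hnf`. [cite: HoffsteinLuo1997, Theorem (§1, pp. 435–436)] [cite: BCDTJAMS2001, Thm. A]
[cite: CastellaEtAl2021, proof of Thm. 5.3.1, conditions (a)–(d)] -/
theorem lightFrameSupplyOdd_of_hoffsteinLuo (hnf : exists_isNewformOf)
    (hHL : HoffsteinLuo1997_exists_twist_L_one_ne_zero) :
    ∀ (W : WeierstrassCurve ℚ) [W.IsElliptic] [W.IsGloballyMinimal] [NeZero (W.conductorNorm ℤ)] (p : ℕ) [Fact p.Prime], Summit.BirchSwinnertonDyer.BirchSwinnertonDyer.Rank1Residual.ClassX9 W p → W.analyticRank = 1 → ∃ (K : Type) (_ : Field K) (_ : NumberField K), Literature.NumberTheory.EllipticCurves.IsImaginaryQuadratic K ∧ Odd (NumberField.discr K) ∧ NumberField.discr K < -4 ∧ Literature.NumberTheory.EllipticCurves.SatisfiesHeegnerHypothesis (W.conductorNorm ℤ) K ∧ Literature.NumberTheory.EllipticCurves.SatisfiesHeegnerHypothesis p K ∧ (W.quadraticTwist (NumberField.discr K : ℚ)).entireLFunction 1 ≠ 0 := by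
  intro W _ _ _ p _ _ hr
  have hw : W.rootNumber = -1 := by
    rw [W.rootNumber_eq_neg_one_pow_analyticRank_of_exists_isNewformOf hnf, hr, pow_one]
  exact Literature.NumberTheory.EllipticCurves.Rank1Residual.exists_admissibleField_of_rootNumber_eq_neg_one
    hnf hHL W hw p

end TorsionLayer

end Summit.BirchSwinnertonDyer.BirchSwinnertonDyer.Rank1Residual

end
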